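import Mathlib
import HarnessLib
import Summits.HubbardSuperconductivity.HubbardSuperconductivity.Theorems.KLProgrammeKLRegimeTwoVolumeReadoutPinStep

/-!
# Route `KLProgramme` — K3 engine / VL children, (E3f-AT)₀ spatial nested leg at the BARE FRAME `K = 0` (scheme F at scale 0 has `K₀ = 0`;
# the VL child's bare carrier): the composed door collapses — no explicit symbols, `τ̌ = δ`, `E = 0` (cell gate-hubbard-kl, seat hubbard-kl-k3c5-p2 g6)

At `K = 0` the K-resummation is trivial: `E = K − K²ũ = 0`, `τ = (1 − Kũ)² = 1`, so the explicit-symbol terms of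
`…TwoVolumeReadoutPinStep.abs_klLocalPart_sub_le_of_copiesStep` vanish (`torusFourierInv 1 = δ₀`: `ℓ¹` norm `1`, first moment `0`; the cosine
coefficients of `0` are `0`) and the two-volume difference of the bare local part is bounded by the Grassmann data alone:

* `torusFourierInv_one`, `sum_norm_torusFourierInv_one` (`= 1`), `sum_tnorm_norm_torusFourierInv_one` (`= 0`), `torusCosCoeff_zero_fun`;
* **`abs_klLocalPart_sub_le_of_copiesStep_zeroFrame`**:
  `|klLocalPart Lc M β U μ 0 n θ − klLocalPart Lf M β U μ 0 n θ| ≤ (2N/|β|)·B + 2·(2N/|β|)·M₂(w)/((Lc−1)/2+1)`,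
  `B` any bound of the pinned block-step sum of the (un-resummed, `p̃ = p` at `K = 0`) quartic grid actions at a pin of residue `(r₀,r₀)`,
  `M₂(w)` the first spatial moment of the fine pinned two-leg kernel.

Proofs only; no definitions.
-/

noncomputable section

namespace Summit.HubbardSuperconductivity.HubbardSuperconductivity.Theorems.TwoVolumeDefect

set_option linter.dupNamespace false -- summit = problem name (single-conjunct summit), D-0017

open Finset Complex Literature.MathematicalPhysics.QuantumLattice Literature.Probability.LatticeModels GrassmannAlgebra
open Summit.HubbardSuperconductivity.HubbardSuperconductivity.Theorems.KLRegimeSplit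
open Summit.HubbardSuperconductivity.HubbardSuperconductivity.Theorems.KLProgrammeLegKernels
open Summit.HubbardSuperconductivity.HubbardSuperconductivity.Theorems.TwoPointAssembly
open scoped ComplexConjugate

section Const

variable {L : ℕ} [NeZero L]

/-- `torusFourierInv 1 = δ₀` on `(ℤ/Lℤ)²`. -/
theorem torusFourierInv_one (z : TorusSite 2 L) : torusFourierInv (fun _ : TorusSite 2 L => (1 : ℂ)) z = if z = 0 then 1 else 0 := by
  rw [torusFourierInv_eq_sum_torusChar]
  simp_rw [one_mul]
  rw [sum_torusChar_left]
  have hL : ((L : ℂ) ^ 2) ≠ 0 := natCast_pow_ne_zero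
  split_ifs <;> simp [hL]

/-- `Σ_z ‖(torusFourierInv 1) z‖ = 1`. -/
theorem sum_norm_torusFourierInv_one : ∑ z : TorusSite 2 L, ‖torusFourierInv (fun _ : TorusSite 2 L => (1 : ℂ)) z‖ = 1 := by
  simp_rw [torusFourierInv_one]
  rw [Finset.sum_eq_single (0 : TorusSite 2 L)]
  · simp
  · intro z _ hz; rw [if_neg hz, norm_zero]
  · intro h; exact absurd (Finset.mem_univ _) h

/-- `Σ_z tnorm(z)·‖(torusFourierInv 1) z‖ = 0`. -/
theorem sum_tnorm_norm_torusFourierInv_one :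
    ∑ z : TorusSite 2 L, (Torus.tnorm z : ℝ) * ‖torusFourierInv (fun _ : TorusSite 2 L => (1 : ℂ)) z‖ = 0 := by
  simp_rw [torusFourierInv_one]
  refine Finset.sum_eq_zero fun z _ => ?_
  by_cases hz : z = 0
  · subst hz
    have : Torus.tnorm (0 : TorusSite 2 L) = 0 := by
      unfold Torus.tnorm Site.supNorm Torus.cRep
      simp [Torus.cRepZ]
    rw [this]; simp
  · rw [if_neg hz, norm_zero, mul_zero]

/-- The cosine coefficients of the zero function vanish. -/
theorem torusCosCoeff_zero_fun (y : TorusSite 2 L) : torusCosCoeff L (fun _ : TorusSite 2 L => (0 : ℝ)) y = 0 := by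
  simp [torusCosCoeff]

end Const

section Door

variable {b Lc Lf M N : ℕ} [NeZero Lc] [NeZero Lf] [NeZero M] [NeZero N]

/-- **THE COMPOSED DOOR AT THE BARE FRAME `K = 0`.**  `0 < β`, `Lf = b·Lc`, `2M ≤ N`, `4M ≤ N + 1`, unit partition functions of the scale-`n`
bare actions at both volumes, a fine pin `w` of residue `(r₀,r₀)` (`r₀ = (Lc−1)/2`), and ANY bound `B` of the pinned block-step sum of the bare quartic
grid actions `W_L = effAction (S_Lᵀ·normalCovariance (uvSymbolCT L M β μ 0 Λ_n)·S_L) (hubbardGridInteraction L N β U)` at `w`: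
`|klLocalPart Lc M β U μ 0 n θ − klLocalPart Lf M β U μ 0 n θ| ≤ (2N/|β|)·B + 2·((2N/|β|)·M₂(w))/((Lc−1)/2+1)`. -/
theorem abs_klLocalPart_sub_le_of_copiesStep_zeroFrame (hL : Lf = b * Lc) {β : ℝ} (hβ : 0 < β) (hN : 2 * M ≤ N) (hN4 : 4 * M ≤ N + 1)
    (U μ : ℝ) (n : ℕ) (w : GridPoint Lf N)
    (hZc : IsUnit (effPartitionFn ℂ (normalCovariance Lc M (uvSymbolCT Lc M β μ 0 (klScale klE0 n))) (hubbardInteraction Lc M β U)))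
    (hZf : IsUnit (effPartitionFn ℂ (normalCovariance Lf M (uvSymbolCT Lf M β μ 0 (klScale klE0 n))) (hubbardInteraction Lf M β U)))
    (hwres : ∀ i, (w.2 i).val % Lc = (Lc - 1) / 2) {B : ℝ}
    (hstep : ∑ X ∈ univ.filter (fun X : Fin 2 → GridLeg (GridPoint Lf N) => X 0 = ((w, 0), 0)),
      ‖kernel ℂ (effAction ℂ ((hubbardGridSub Lf M β N).transpose * normalCovariance Lf M (uvSymbolCT Lf M β μ 0 (klScale klE0 n)) *
          hubbardGridSub Lf M β N) (hubbardGridInteraction Lf N β U)) 2 X -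
        (if ∀ i j, ((X i).1.1.2 j).val / Lc = ((X 0).1.1.2 j).val / Lc then
          kernel ℂ (effAction ℂ ((hubbardGridSub Lc M β N).transpose * normalCovariance Lc M (uvSymbolCT Lc M β μ 0 (klScale klE0 n)) *
            hubbardGridSub Lc M β N) (hubbardGridInteraction Lc N β U)) 2
            (fun i => ((((X i).1.1.1, fun j => ((((X i).1.1.2 j).val : ℕ) : ZMod Lc)), (X i).1.2), (X i).2)) else 0)‖ ≤ B)
    (θ : ℝ) :
    |klLocalPart Lc M β U μ 0 n θ - klLocalPart Lf M β U μ 0 n θ| ≤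
      2 * N / |β| * B +
        2 * ((2 * N / |β| * ∑ p₁' : GridPoint Lf N, (Torus.tnorm (p₁'.2 - w.2) : ℝ) *
              ‖kernel ℂ (effAction ℂ ((hubbardGridSub Lf M β N).transpose * normalCovariance Lf M (uvSymbolCT Lf M β μ 0 (klScale klE0 n)) *
          hubbardGridSub Lf M β N) (hubbardGridInteraction Lf N β U)) 2 (fun i => ((![w, p₁'] i, 0), i))‖) /
          (((Lc - 1) / 2 + 1 : ℕ) : ℝ)) := by
  have hZc' : IsUnit (effPartitionFn ℂ (normalCovariance Lc M (uvSymbolCT Lc M β μ (0 : TrigPolyC4v) (klScale klE0 n)))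
      (hubbardInteraction Lc M β U + counterQuadratic Lc M β (0 : TrigPolyC4v))) := by simpa only [counterQuadratic_zero, add_zero] using hZc
  have hZf' : IsUnit (effPartitionFn ℂ (normalCovariance Lf M (uvSymbolCT Lf M β μ (0 : TrigPolyC4v) (klScale klE0 n)))
      (hubbardInteraction Lf M β U + counterQuadratic Lf M β (0 : TrigPolyC4v))) := by simpa only [counterQuadratic_zero, add_zero] using hZf
  have hstep' : ∑ X ∈ univ.filter (fun X : Fin 2 → GridLeg (GridPoint Lf N) => X 0 = ((w, 0), 0)),
      ‖kernel ℂ (effAction ℂ ((hubbardGridSub Lf M β N).transpose *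
              normalCovariance Lf M (fun ks => uvSymbolCT Lf M β μ (0 : TrigPolyC4v) (klScale klE0 n) ks /
                (1 + uvSymbolCT Lf M β μ (0 : TrigPolyC4v) (klScale klE0 n) ks * (((0 : TrigPolyC4v).eval (latticeMomentum Lf ks.1.2) / (β * (Lf : ℝ) ^ 2) : ℝ) : ℂ))) *
              hubbardGridSub Lf M β N) (hubbardGridInteraction Lf N β U)) 2 X -
        (if ∀ i j, ((X i).1.1.2 j).val / Lc = ((X 0).1.1.2 j).val / Lc then
          kernel ℂ (effAction ℂ ((hubbardGridSub Lc M β N).transpose *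
              normalCovariance Lc M (fun ks => uvSymbolCT Lc M β μ (0 : TrigPolyC4v) (klScale klE0 n) ks /
                (1 + uvSymbolCT Lc M β μ (0 : TrigPolyC4v) (klScale klE0 n) ks * (((0 : TrigPolyC4v).eval (latticeMomentum Lc ks.1.2) / (β * (Lc : ℝ) ^ 2) : ℝ) : ℂ))) *
              hubbardGridSub Lc M β N) (hubbardGridInteraction Lc N β U)) 2
            (fun i => ((((X i).1.1.1, fun j => ((((X i).1.1.2 j).val : ℕ) : ZMod Lc)), (X i).1.2), (X i).2)) else 0)‖ ≤ B := by
    simpa only [TrigPolyC4v.eval_zero, Complex.ofReal_zero, zero_div, mul_zero, add_zero, div_one] using hstep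
  have h := abs_klLocalPart_sub_le_of_copiesStep hL hβ hN hN4 U μ 0 n w hZc' hZf' hwres hstep' θ
  simp only [TrigPolyC4v.eval_zero, Complex.ofReal_zero, sq, zero_mul, mul_zero, sub_zero, zero_div, div_one,
    Complex.zero_re, torusCosCoeff_zero_fun, abs_zero, Finset.sum_const_zero, sum_norm_torusFourierInv_one,
    sum_tnorm_norm_torusFourierInv_one, one_mul, add_zero, zero_add] at h
  exact h

end Door

end Summit.HubbardSuperconductivity.HubbardSuperconductivity.Theorems.TwoVolumeDefect

end
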